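import Summits.QuantumFields.BalabanUV.T4Continuum.Support.NE3CovariantCompetitor
import HarnessLib

/-!
# T⁴ programme, node NE3 — row E-MLw-(w4)-P-curved, route H♮, row K5c (file 7a): THE ℓ² VALUES OF THE S7 COMPETITOR

NE3 (node U1b) formalisation swarm, leaf seat `b2b-balaban-t4-ne3-formalise-leaf-01` (gen 7); row **K5** of ruling ρ-g22-2, sub-row
**K5c**, file 7a (INTENT `HOME/CLAIMS.log` l.20672).  WHY.  File 6c's energy END `NE3CompetitorSlice.sum_normSq_gaugeDir_nfixCompetitorW_le`
carries the nested-mean defect `Σ_z ‖bmeanIterW ζ′ z − bmeanIterW (competitorW …) z‖²`; at the consumer's datum `b := bmeanIterW ζ′`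
(K6c-1b, leaf-02 lineage) and with `bmeanW_competitorW = b` EXACT this is `Σ_z ‖bmeanW F₀ z − bmeanIterW F₀ z‖²`, which the J2 bridge
`NE3NestedBlockMeanBridge.sum_norm_bmeanIterW_sub_bmeanW_sq_le` converts into `E_j²·M^{−d}·Σ_y ‖F₀ y‖²` — the ℓ² norm of the VALUES of the
competitor `F₀ = competitorW M W b c`.  Files 1–5 bound corners, block means and GRADIENT energies only; THIS FILE supplies the value bound.

CONTENT ([folklore]; 0 sorry; 0 def), `M, N ≥ 1` (`M ≥ 2` where the bump coefficient enters), `W` unitary, data `N`-periodic: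
§1 `normSq_tinterpW_le` (`‖tinterpW M W m y‖² ≤ Σ_{T ⊆ univ} ‖m (blk M y + indic T)‖²`: local convexity `NE3CoarseInterpolant.normSq_interp_le`
   + unitary transports) and **`sum_normSq_tinterpW_le`**: `Σ_{y∈periodBox (M·N)} ‖tinterpW M W m y‖² ≤ 2^d·M^d·Σ_{z∈periodBox N} ‖m z‖²`;
§2 `sum_normSq_spikeW_eq`: `Σ_{y∈periodBox (M·N)} ‖spikeW M h y‖² = Σ_{z∈periodBox N} ‖h z‖²`;
§3 `norm_dressW_eq`, `norm_dressW_bump_le`, **`sum_normSq_dressW_bump_le`**: `Σ_{y∈periodBox (M·N)} ‖dressW M W (bump M c) y‖² ≤ M^d·Σ_{z∈periodBox N} ‖c z‖²`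
   (`tent ≤ 1`, crude and honest);
§4 **`sum_normSq_compCoef_le`** — file 5's internal coefficient bound, exported (letters of file 5: `D = Σ_zΣ_α ‖gaugeDir U b z α‖²`,
   `S_b = Σ_z ‖b z‖²`, `S_h = Σ_z ‖c z − b z‖²`, `K₂ = 2^{2d+4}d²(d−1)²a_U² + 8(9d²M²a + dδ)²`):
   `Σ_z ‖compCoef M W b c z‖² ≤ 2·64^d·(2^{3d+2}·d·D + 2^d·K₂·S_b) + 2·64^d·((M^d)⁻¹)²·S_h`;
§5 **THE END `sum_normSq_competitorW_le`**:
   `Σ_{y∈periodBox (M·N)} ‖competitorW M W b c y‖² ≤ 3·(2^d·M^d·S_b) + 3·S_h + 3·(M^d·[2·64^d·(2^{3d+2}·d·D + 2^d·K₂·S_b) + 2·64^d·((M^d)⁻¹)²·S_h])`.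
POWER COUNT (route H♮ budget, D-ne3r2-g9-3 ∕ g10-1): this enters the K6 assembly only through the nested fix, multiplied by
`2·d·M^d·κ²·(2∕tentMean)²·E_j²·M^{−d}` (`κ ≈ 1∕M`, `E_j = O(θ)`), i.e. at order `(E_j∕ε)²` against `G` — inside the census.

HONEST FRAMING.  Kinematics of OUR competitor at one background in the small-field class; nothing about Bałaban's minimisers;
(P♮)_W ∕ (ML_w) at W ≠ 1, T-E_w and **NE3 are NOT proved**; spine PROVED 0∕9; finite T⁴ rung (B)+1 — NOT infinite volume, NOT
mass gap, NOT `BetaPertH`, NOT Clay.  PLACEMENT: `Summits/QuantumFields/BalabanUV/`.  HONEST DEPENDENCY (cell page 1): continuum YM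
on T⁴ ⇐ BetaPertH ∧ nine spine estimates (0/9 proved); BetaPertH ⇐ (D1) ∧ (D4) ∧ CAP+tail; G-an2-4 gates asym, D1 and NE2/3/4.
-/

set_option autoImplicit false

open scoped BigOperators Matrix.Norms.L2Operator
open Finset

namespace Summit.QuantumFields.BalabanUV.T4Continuum.NE3CovariantCompetitorValue

open Literature.MathematicalPhysics.QuantumFieldTheory.Balaban1983to89
open B7Prop1Explicit B7Prop2Explicit
open T4AveragingDeficitWall (IsUnitaryCfg SmallField Ad)
open T4AveragingDeficitWallBoundary (periodBox mem_periodBox card_periodBox IsPeriodicCfg sum_periodBox_shift)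
open AveragingDeficitTransport (norm_Ad_of_unitary)
open AveragingDeficitBlockDensity (btree bseg btree_mem)
open BlockAveragePushDirGauge (gaugeDir)
open SmoothRefineBlocks (blk)
open SmoothRefineInterp (indic interp)
open NE3CoarseInterpolant (normSq_interp_le blk_block)
open NE3BlockLineAverage (sum_periodBox_blocks)
open NE3TentBump (tent tent_nonneg tent_le_one bump)
open NE3CovariantBlockMean (bmeanW)
open NE3DressedBlockField (dressW)
open NE3CovariantTentInterpolant (vtxW tinterpW)
open NE3CovariantTentInterpolantMeanDefect (normSq_sub_bmeanW_tinterpW_le)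
open NE3CornerSpikes (spikeW sum_block_normSq_spikeW)
open NE3CovariantCompetitor (compCoef competitorW norm_compCoef_le)

noncomputable section

variable {d : ℕ} {n : Type*} [Fintype n] [DecidableEq n]

/-! ## §1 The values of the covariant tent interpolant -/

/-- **LOCAL CONVEXITY FOR THE COVARIANT TENT INTERPOLANT**: `‖tinterpW M W m y‖² ≤ Σ_{T ⊆ univ} ‖m (blk M y + indic T)‖²` (`M ≥ 1`,
`W` unitary) — the flat local convexity `normSq_interp_le` applied to the transported vertex data, whose norms are those of `m`
(unitary transports). [folklore] -/
theorem normSq_tinterpW_le {M : ℕ} (hM : 1 ≤ M) {W : Site d → Fin d → (Matrix n n ℂ)ˣ} (hW : IsUnitaryCfg W)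
    (m : Site d → Matrix n n ℂ) (y : Site d) :
    ‖tinterpW M W m y‖ ^ 2 ≤ ∑ T ∈ (Finset.univ : Finset (Fin d)).powerset, ‖m (blk M y + indic T)‖ ^ 2 := by
  unfold tinterpW
  refine (normSq_interp_le hM Finset.univ (vtxW M W m y) y).trans (le_of_eq (Finset.sum_congr rfl fun T _ => ?_))
  unfold vtxW
  rw [norm_Ad_of_unitary ((unitaryUnits _).inv_mem (btree_mem hW M _ _))]

/-- **THE ℓ² VALUES OF THE COVARIANT TENT INTERPOLANT** (`M, N ≥ 1`, `W` unitary, `m` `N`-periodic):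
`Σ_{y∈periodBox (M·N)} ‖tinterpW M W m y‖² ≤ 2^d·M^d·Σ_{z∈periodBox N} ‖m z‖²` — each block reads the `2^d` vertices of its cube,
each vertex shift is a periodic shift of the `z`-sum. [folklore] -/
theorem sum_normSq_tinterpW_le {M N : ℕ} (hM : 1 ≤ M) (hN : 1 ≤ N) {W : Site d → Fin d → (Matrix n n ℂ)ˣ} (hW : IsUnitaryCfg W)
    {m : Site d → Matrix n n ℂ} (hm : ∀ (z : Site d) (τ : Fin d), m (z + (N : ℤ) • e τ) = m z) :
    ∑ y ∈ periodBox (d := d) (M * N), ‖tinterpW M W m y‖ ^ 2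
      ≤ (2 : ℝ) ^ d * (M : ℝ) ^ d * ∑ z ∈ periodBox (d := d) N, ‖m z‖ ^ 2 := by
  -- pointwise, then block by block
  have hpt := fun y => normSq_tinterpW_le hM hW m y
  have hblocks : ∑ y ∈ periodBox (d := d) (M * N), ∑ T ∈ (Finset.univ : Finset (Fin d)).powerset, ‖m (blk M y + indic T)‖ ^ 2
      = (M : ℝ) ^ d * ∑ z ∈ periodBox (d := d) N, ∑ T ∈ (Finset.univ : Finset (Fin d)).powerset, ‖m (z + indic T)‖ ^ 2 := by
    rw [← sum_periodBox_blocks M N hM, Finset.mul_sum]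
    refine Finset.sum_congr rfl fun z _ => ?_
    rw [Finset.sum_congr rfl fun v hv => by rw [blk_block hM z hv], Finset.sum_const, card_periodBox, nsmul_eq_mul, Nat.cast_pow]
  -- each vertex shift is a periodic shift of the `z`-sum
  have hshift : ∀ T : Finset (Fin d),
      ∑ z ∈ periodBox (d := d) N, ‖m (z + indic T)‖ ^ 2 = ∑ z ∈ periodBox (d := d) N, ‖m z‖ ^ 2 :=
    fun T => sum_periodBox_shift N hN (g := fun z => ‖m z‖ ^ 2) (fun x κ => by simp only [hm]) (indic T)
  have hpow : (((Finset.univ : Finset (Fin d)).powerset.card : ℝ)) = (2 : ℝ) ^ d := by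
    rw [Finset.card_powerset, Finset.card_univ, Fintype.card_fin]; push_cast; ring
  calc ∑ y ∈ periodBox (d := d) (M * N), ‖tinterpW M W m y‖ ^ 2
      ≤ ∑ y ∈ periodBox (d := d) (M * N), ∑ T ∈ (Finset.univ : Finset (Fin d)).powerset, ‖m (blk M y + indic T)‖ ^ 2 :=
        Finset.sum_le_sum fun y _ => hpt y
    _ = (M : ℝ) ^ d * ∑ z ∈ periodBox (d := d) N, ∑ T ∈ (Finset.univ : Finset (Fin d)).powerset, ‖m (z + indic T)‖ ^ 2 := hblocks
    _ = (M : ℝ) ^ d * ((2 : ℝ) ^ d * ∑ z ∈ periodBox (d := d) N, ‖m z‖ ^ 2) := by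
        rw [Finset.sum_comm, Finset.sum_congr rfl fun T _ => hshift T, Finset.sum_const, nsmul_eq_mul, hpow]
    _ = (2 : ℝ) ^ d * (M : ℝ) ^ d * ∑ z ∈ periodBox (d := d) N, ‖m z‖ ^ 2 := by ring

/-! ## §2 The values of the spike field -/

/-- **THE ℓ² VALUES OF THE SPIKE FIELD** (`M ≥ 1`, any `N`): `Σ_{y∈periodBox (M·N)} ‖spikeW M h y‖² = Σ_{z∈periodBox N} ‖h z‖²`. [folklore] -/
theorem sum_normSq_spikeW_eq {M : ℕ} (hM : 1 ≤ M) (N : ℕ) (h : Site d → Matrix n n ℂ) :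
    ∑ y ∈ periodBox (d := d) (M * N), ‖spikeW M h y‖ ^ 2 = ∑ z ∈ periodBox (d := d) N, ‖h z‖ ^ 2 := by
  rw [← sum_periodBox_blocks M N hM]
  exact Finset.sum_congr rfl fun z _ => sum_block_normSq_spikeW hM h z

/-! ## §3 The values of the dressed bump -/

/-- The dressing is an isometry pointwise: `‖dressW M W F x‖ = ‖F x‖` (`W` unitary). [folklore] -/
theorem norm_dressW_eq (M : ℕ) {W : Site d → Fin d → (Matrix n n ℂ)ˣ} (hW : IsUnitaryCfg W) (F : Site d → Matrix n n ℂ)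
    (x : Site d) : ‖dressW M W F x‖ = ‖F x‖ := by
  unfold dressW
  rw [norm_Ad_of_unitary ((unitaryUnits _).inv_mem (btree_mem hW M _ _))]

/-- The dressed bump is pointwise at most its coefficient: `‖dressW M W (bump M c) y‖ ≤ ‖c (blk M y)‖` (`M ≥ 1`, `tent ≤ 1`). [folklore] -/
theorem norm_dressW_bump_le {M : ℕ} (hM : 1 ≤ M) {W : Site d → Fin d → (Matrix n n ℂ)ˣ} (hW : IsUnitaryCfg W)
    (c : Site d → Matrix n n ℂ) (y : Site d) : ‖dressW M W (bump M c) y‖ ≤ ‖c (blk M y)‖ := by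
  rw [norm_dressW_eq M hW]
  unfold bump
  rw [norm_smul, Real.norm_of_nonneg (tent_nonneg hM y)]
  calc tent M y * ‖c (blk M y)‖ ≤ 1 * ‖c (blk M y)‖ := mul_le_mul_of_nonneg_right (tent_le_one hM y) (norm_nonneg _)
    _ = ‖c (blk M y)‖ := one_mul _

/-- **THE ℓ² VALUES OF THE DRESSED BUMP** (`M ≥ 1`, any `N`): `Σ_{y∈periodBox (M·N)} ‖dressW M W (bump M c) y‖² ≤ M^d·Σ_{z∈periodBox N} ‖c z‖²`. [folklore] -/
theorem sum_normSq_dressW_bump_le {M : ℕ} (hM : 1 ≤ M) (N : ℕ) {W : Site d → Fin d → (Matrix n n ℂ)ˣ} (hW : IsUnitaryCfg W)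
    (c : Site d → Matrix n n ℂ) :
    ∑ y ∈ periodBox (d := d) (M * N), ‖dressW M W (bump M c) y‖ ^ 2 ≤ (M : ℝ) ^ d * ∑ z ∈ periodBox (d := d) N, ‖c z‖ ^ 2 := by
  have hpt : ∀ y, ‖dressW M W (bump M c) y‖ ^ 2 ≤ ‖c (blk M y)‖ ^ 2 :=
    fun y => pow_le_pow_left₀ (norm_nonneg _) (norm_dressW_bump_le hM hW c y) 2
  calc ∑ y ∈ periodBox (d := d) (M * N), ‖dressW M W (bump M c) y‖ ^ 2
      ≤ ∑ y ∈ periodBox (d := d) (M * N), ‖c (blk M y)‖ ^ 2 := Finset.sum_le_sum fun y _ => hpt y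
    _ = (M : ℝ) ^ d * ∑ z ∈ periodBox (d := d) N, ‖c z‖ ^ 2 := by
        rw [← sum_periodBox_blocks M N hM, Finset.mul_sum]
        refine Finset.sum_congr rfl fun z _ => ?_
        rw [Finset.sum_congr rfl fun v hv => by rw [blk_block hM z hv], Finset.sum_const, card_periodBox, nsmul_eq_mul,
          Nat.cast_pow]

/-! ## §4 The competitor's coefficient against the data (file 5's internal bound, exported) -/

/-- **THE ℓ² SIZE OF THE MEAN-CORRECTION COEFFICIENT** (`M ≥ 2`, `N ≥ 1`, `d ≥ 1`; `W`, `U` unitary, `SmallField W a`, `SmallField U a_U`,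
`‖U − bseg M W‖ ≤ δ` bondwise, `U` and `b` `N`-periodic):
`Σ_z ‖compCoef M W b c z‖² ≤ 2·64^d·(2^{3d+2}·d·D + 2^d·K₂·S_b) + 2·64^d·((M^d)⁻¹)²·S_h`, `K₂ = 2^{2d+4}d²(d−1)²a_U² + 8(9d²M²a + dδ)²` —
`norm_compCoef_le` squared, file 4's defect bound `normSq_sub_bmeanW_tinterpW_le`, and the periodic shifts of the cube sums. [folklore] -/
theorem sum_normSq_compCoef_le [Nonempty n] {M N : ℕ} (hM : 2 ≤ M) (hN : 1 ≤ N) (hd : 0 < d)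
    {W U : Site d → Fin d → (Matrix n n ℂ)ˣ} (hW : IsUnitaryCfg W) (hU : IsUnitaryCfg U) {a aU δ : ℝ} (ha : 0 ≤ a) (haU : 0 ≤ aU)
    (hWa : SmallField W a) (hUa : SmallField U aU)
    (hδ : ∀ (w : Site d) (α : Fin d), ‖((U w α : (Matrix n n ℂ)ˣ) : Matrix n n ℂ) - bseg M W w α‖ ≤ δ)
    (hUP : IsPeriodicCfg U (N : ℤ)) {b : Site d → Matrix n n ℂ}
    (hb : ∀ (z : Site d) (τ : Fin d), b (z + (N : ℤ) • e τ) = b z) (c : Site d → Matrix n n ℂ) :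
    ∑ z ∈ periodBox (d := d) N, ‖compCoef M W b c z‖ ^ 2
      ≤ 2 * (64 : ℝ) ^ d
          * ((2 : ℝ) ^ (3 * d + 2) * d * ∑ z ∈ periodBox (d := d) N, ∑ α : Fin d, ‖gaugeDir U b z α‖ ^ 2
            + (2 : ℝ) ^ d * ((2 : ℝ) ^ (2 * d + 4) * (d : ℝ) ^ 2 * ((d : ℝ) - 1) ^ 2 * aU ^ 2
                + 8 * (9 * (d : ℝ) ^ 2 * (M : ℝ) ^ 2 * a + (d : ℝ) * δ) ^ 2) * ∑ z ∈ periodBox (d := d) N, ‖b z‖ ^ 2)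
        + 2 * (64 : ℝ) ^ d * (((M : ℝ) ^ d)⁻¹) ^ 2 * ∑ z ∈ periodBox (d := d) N, ‖c z - b z‖ ^ 2 := by
  have hM1 : 1 ≤ M := by omega
  have hδ0 : 0 ≤ δ := (norm_nonneg _).trans (hδ 0 ⟨0, hd⟩)
  have hcoefpt : ∀ z : Site d, ‖compCoef M W b c z‖ ^ 2
      ≤ 2 * (64 : ℝ) ^ d * ‖b z - bmeanW M W (tinterpW M W b) z‖ ^ 2 + 2 * (64 : ℝ) ^ d * ((((M : ℝ) ^ d)⁻¹) * ‖c z - b z‖) ^ 2 := by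
    intro z
    have h := norm_compCoef_le hM W b c z
    have h64 : ((8 : ℝ) ^ d) ^ 2 = (64 : ℝ) ^ d := by rw [← pow_mul, mul_comm, pow_mul]; norm_num
    calc ‖compCoef M W b c z‖ ^ 2
        ≤ ((8 : ℝ) ^ d * (‖b z - bmeanW M W (tinterpW M W b) z‖ + ((M : ℝ) ^ d)⁻¹ * ‖c z - b z‖)) ^ 2 :=
          pow_le_pow_left₀ (norm_nonneg _) h 2
      _ = (64 : ℝ) ^ d * (‖b z - bmeanW M W (tinterpW M W b) z‖ + ((M : ℝ) ^ d)⁻¹ * ‖c z - b z‖) ^ 2 := by rw [mul_pow, h64]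
      _ ≤ (64 : ℝ) ^ d * (2 * ‖b z - bmeanW M W (tinterpW M W b) z‖ ^ 2 + 2 * (((M : ℝ) ^ d)⁻¹ * ‖c z - b z‖) ^ 2) := by
          refine mul_le_mul_of_nonneg_left ?_ (by positivity)
          nlinarith only [sq_nonneg (‖b z - bmeanW M W (tinterpW M W b) z‖ - ((M : ℝ) ^ d)⁻¹ * ‖c z - b z‖)]
      _ = _ := by ring
  have hdef : ∀ z : Site d, ‖b z - bmeanW M W (tinterpW M W b) z‖ ^ 2
      ≤ (2 : ℝ) ^ (2 * d + 2) * d * ∑ S ∈ (Finset.univ : Finset (Fin d)).powerset, ∑ i : Fin d, ‖gaugeDir U b (z + indic S) i‖ ^ 2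
        + ((2 : ℝ) ^ (2 * d + 4) * (d : ℝ) ^ 2 * ((d : ℝ) - 1) ^ 2 * aU ^ 2
            + 8 * (9 * (d : ℝ) ^ 2 * (M : ℝ) ^ 2 * a + (d : ℝ) * δ) ^ 2)
          * ∑ T ∈ (Finset.univ : Finset (Fin d)).powerset, ‖b (z + indic T)‖ ^ 2 :=
    fun z => normSq_sub_bmeanW_tinterpW_le hM1 hW hU ha haU hδ0 hWa hUa hδ b z
  have hshiftD : ∀ S : Finset (Fin d), ∑ z ∈ periodBox (d := d) N, ∑ i : Fin d, ‖gaugeDir U b (z + indic S) i‖ ^ 2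
      = ∑ z ∈ periodBox (d := d) N, ∑ α : Fin d, ‖gaugeDir U b z α‖ ^ 2 := by
    intro S
    refine sum_periodBox_shift N hN (g := fun z => ∑ i : Fin d, ‖gaugeDir U b z i‖ ^ 2) (fun x κ => ?_) (indic S)
    refine Finset.sum_congr rfl fun i _ => ?_
    simp only [gaugeDir]
    rw [hUP x κ i, add_right_comm, hb, hb]
  have hshiftB : ∀ T : Finset (Fin d), ∑ z ∈ periodBox (d := d) N, ‖b (z + indic T)‖ ^ 2 = ∑ z ∈ periodBox (d := d) N, ‖b z‖ ^ 2 :=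
    fun T => sum_periodBox_shift N hN (g := fun z => ‖b z‖ ^ 2) (fun x κ => by simp only [hb]) (indic T)
  have hpow : (((Finset.univ : Finset (Fin d)).powerset.card : ℝ)) = (2 : ℝ) ^ d := by
    rw [Finset.card_powerset, Finset.card_univ, Fintype.card_fin]; push_cast; ring
  have hdefsum : ∑ z ∈ periodBox (d := d) N, ‖b z - bmeanW M W (tinterpW M W b) z‖ ^ 2
      ≤ (2 : ℝ) ^ (3 * d + 2) * d * ∑ z ∈ periodBox (d := d) N, ∑ α : Fin d, ‖gaugeDir U b z α‖ ^ 2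
        + (2 : ℝ) ^ d * ((2 : ℝ) ^ (2 * d + 4) * (d : ℝ) ^ 2 * ((d : ℝ) - 1) ^ 2 * aU ^ 2
            + 8 * (9 * (d : ℝ) ^ 2 * (M : ℝ) ^ 2 * a + (d : ℝ) * δ) ^ 2) * ∑ z ∈ periodBox (d := d) N, ‖b z‖ ^ 2 := by
    refine (Finset.sum_le_sum fun z _ => hdef z).trans (le_of_eq ?_)
    have hA : ∑ z ∈ periodBox (d := d) N, ∑ S ∈ (Finset.univ : Finset (Fin d)).powerset, ∑ i : Fin d, ‖gaugeDir U b (z + indic S) i‖ ^ 2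
        = (2 : ℝ) ^ d * ∑ z ∈ periodBox (d := d) N, ∑ α : Fin d, ‖gaugeDir U b z α‖ ^ 2 := by
      rw [Finset.sum_comm, Finset.sum_congr rfl fun S _ => hshiftD S, Finset.sum_const, nsmul_eq_mul, hpow]
    have hB : ∑ z ∈ periodBox (d := d) N, ∑ T ∈ (Finset.univ : Finset (Fin d)).powerset, ‖b (z + indic T)‖ ^ 2
        = (2 : ℝ) ^ d * ∑ z ∈ periodBox (d := d) N, ‖b z‖ ^ 2 := by
      rw [Finset.sum_comm, Finset.sum_congr rfl fun T _ => hshiftB T, Finset.sum_const, nsmul_eq_mul, hpow]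
    rw [Finset.sum_add_distrib, ← Finset.mul_sum, ← Finset.mul_sum, hA, hB, show 3 * d + 2 = d + (2 * d + 2) by ring, pow_add]
    ring
  have h1 : ∑ z ∈ periodBox (d := d) N, ‖compCoef M W b c z‖ ^ 2
      ≤ ∑ z ∈ periodBox (d := d) N, (2 * (64 : ℝ) ^ d * ‖b z - bmeanW M W (tinterpW M W b) z‖ ^ 2
          + 2 * (64 : ℝ) ^ d * ((((M : ℝ) ^ d)⁻¹) * ‖c z - b z‖) ^ 2) := Finset.sum_le_sum fun z _ => hcoefpt z
  have h2 : ∑ z ∈ periodBox (d := d) N, (2 * (64 : ℝ) ^ d * ‖b z - bmeanW M W (tinterpW M W b) z‖ ^ 2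
          + 2 * (64 : ℝ) ^ d * ((((M : ℝ) ^ d)⁻¹) * ‖c z - b z‖) ^ 2)
      = 2 * (64 : ℝ) ^ d * ∑ z ∈ periodBox (d := d) N, ‖b z - bmeanW M W (tinterpW M W b) z‖ ^ 2
        + 2 * (64 : ℝ) ^ d * (((M : ℝ) ^ d)⁻¹) ^ 2 * ∑ z ∈ periodBox (d := d) N, ‖c z - b z‖ ^ 2 := by
    rw [Finset.sum_add_distrib, ← Finset.mul_sum, Finset.mul_sum, Finset.mul_sum]
    congr 1
    exact Finset.sum_congr rfl fun z _ => by ring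
  have h64 : (0 : ℝ) ≤ 2 * (64 : ℝ) ^ d := by positivity
  have h3 := mul_le_mul_of_nonneg_left hdefsum h64
  linarith only [h1, h2.le, h2.ge, h3]

/-! ## §5 The ℓ² values of the competitor -/

/-- `‖A + B + C‖² ≤ 3‖A‖² + 3‖B‖² + 3‖C‖²`. [folklore] -/
theorem normSq_add₃_le {X : Type*} [SeminormedAddCommGroup X] (A B C : X) :
    ‖A + B + C‖ ^ 2 ≤ 3 * ‖A‖ ^ 2 + 3 * ‖B‖ ^ 2 + 3 * ‖C‖ ^ 2 := by
  have h := norm_add₃_le (a := A) (b := B) (c := C)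
  calc ‖A + B + C‖ ^ 2 ≤ (‖A‖ + ‖B‖ + ‖C‖) ^ 2 := pow_le_pow_left₀ (norm_nonneg _) h 2
    _ ≤ _ := by nlinarith only [sq_nonneg (‖A‖ - ‖B‖), sq_nonneg (‖A‖ - ‖C‖), sq_nonneg (‖B‖ - ‖C‖)]

/-- **THE ℓ² VALUES OF THE S7 COMPETITOR** (`M ≥ 2`, `N ≥ 1`, `d ≥ 1`; `W`, `U` unitary, `SmallField W a`, `SmallField U a_U`,
`‖U − bseg M W‖ ≤ δ` bondwise, `U`, `b` `N`-periodic; letters `D = Σ_zΣ_α ‖gaugeDir U b z α‖²`, `S_b = Σ_z ‖b z‖²`, `S_h = Σ_z ‖c z − b z‖²`,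
`K₂ = 2^{2d+4}d²(d−1)²a_U² + 8(9d²M²a + dδ)²`):
`Σ_{y∈periodBox (M·N)} ‖competitorW M W b c y‖² ≤ 3·(2^d·M^d·S_b) + 3·S_h + 3·(M^d·[2·64^d·(2^{3d+2}·d·D + 2^d·K₂·S_b) + 2·64^d·((M^d)⁻¹)²·S_h])`
— §1 + §2 + §3 + §4. [folklore] -/
theorem sum_normSq_competitorW_le [Nonempty n] {M N : ℕ} (hM : 2 ≤ M) (hN : 1 ≤ N) (hd : 0 < d)
    {W U : Site d → Fin d → (Matrix n n ℂ)ˣ} (hW : IsUnitaryCfg W) (hU : IsUnitaryCfg U) {a aU δ : ℝ} (ha : 0 ≤ a) (haU : 0 ≤ aU)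
    (hWa : SmallField W a) (hUa : SmallField U aU)
    (hδ : ∀ (w : Site d) (α : Fin d), ‖((U w α : (Matrix n n ℂ)ˣ) : Matrix n n ℂ) - bseg M W w α‖ ≤ δ)
    (hUP : IsPeriodicCfg U (N : ℤ)) {b : Site d → Matrix n n ℂ}
    (hb : ∀ (z : Site d) (τ : Fin d), b (z + (N : ℤ) • e τ) = b z) (c : Site d → Matrix n n ℂ) :
    ∑ y ∈ periodBox (d := d) (M * N), ‖competitorW M W b c y‖ ^ 2
      ≤ 3 * ((2 : ℝ) ^ d * (M : ℝ) ^ d * ∑ z ∈ periodBox (d := d) N, ‖b z‖ ^ 2)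
        + 3 * ∑ z ∈ periodBox (d := d) N, ‖c z - b z‖ ^ 2
        + 3 * ((M : ℝ) ^ d
            * (2 * (64 : ℝ) ^ d
                * ((2 : ℝ) ^ (3 * d + 2) * d * ∑ z ∈ periodBox (d := d) N, ∑ α : Fin d, ‖gaugeDir U b z α‖ ^ 2
                  + (2 : ℝ) ^ d * ((2 : ℝ) ^ (2 * d + 4) * (d : ℝ) ^ 2 * ((d : ℝ) - 1) ^ 2 * aU ^ 2
                      + 8 * (9 * (d : ℝ) ^ 2 * (M : ℝ) ^ 2 * a + (d : ℝ) * δ) ^ 2) * ∑ z ∈ periodBox (d := d) N, ‖b z‖ ^ 2)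
              + 2 * (64 : ℝ) ^ d * (((M : ℝ) ^ d)⁻¹) ^ 2 * ∑ z ∈ periodBox (d := d) N, ‖c z - b z‖ ^ 2)) := by
  have hM1 : 1 ≤ M := by omega
  -- the three pieces
  have hE1 := sum_normSq_tinterpW_le (M := M) hM1 hN hW hb
  have hE2 := sum_normSq_spikeW_eq (d := d) (n := n) hM1 N (fun z => c z - b z)
  have hE3 := sum_normSq_dressW_bump_le hM1 N hW (compCoef M W b c)
  have hcoef := sum_normSq_compCoef_le hM hN hd hW hU ha haU hWa hUa hδ hUP hb c
  -- split the value into the three pieces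
  have hsplit : ∀ y : Site d, ‖competitorW M W b c y‖ ^ 2
      ≤ 3 * ‖tinterpW M W b y‖ ^ 2 + 3 * ‖spikeW M (fun z => c z - b z) y‖ ^ 2
        + 3 * ‖dressW M W (bump M (compCoef M W b c)) y‖ ^ 2 := fun y => normSq_add₃_le _ _ _
  have hsum : ∑ y ∈ periodBox (d := d) (M * N), ‖competitorW M W b c y‖ ^ 2
      ≤ 3 * ∑ y ∈ periodBox (d := d) (M * N), ‖tinterpW M W b y‖ ^ 2
        + 3 * ∑ y ∈ periodBox (d := d) (M * N), ‖spikeW M (fun z => c z - b z) y‖ ^ 2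
        + 3 * ∑ y ∈ periodBox (d := d) (M * N), ‖dressW M W (bump M (compCoef M W b c)) y‖ ^ 2 := by
    refine (Finset.sum_le_sum fun y _ => hsplit y).trans (le_of_eq ?_)
    simp only [Finset.sum_add_distrib, Finset.mul_sum]
  have hMd : (0 : ℝ) ≤ (M : ℝ) ^ d := by positivity
  have hE3' := hE3.trans (mul_le_mul_of_nonneg_left hcoef hMd)
  linarith only [hsum, hE1, hE2.le, hE3']

end

end Summit.QuantumFields.BalabanUV.T4Continuum.NE3CovariantCompetitorValue
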